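import Literature.NumberTheory.LFunctions.LagariasXiPositivity
import Literature.NumberTheory.LFunctions.ZetaLogDerivRePartialFraction
import Literature.NumberTheory.LFunctions.ZetaZerosProofs
import Literature.NumberTheory.LFunctions.ZetaZerosReflection
import Literature.NumberTheory.LFunctions.RHWave0HardyProofs
import Literature.NumberTheory.LFunctions.GeneralizedRH
import Literature.NumberTheory.LFunctions.RiemannXiProofs
import HarnessLib

/-!
# Lagarias 1999, (1.4) and (1.5): discharge of the named facts (Hinkkanen / Sondow–Dumitrescu positivity of `Re ξ'/ξ`)

Topic `Literature/NumberTheory/LFunctions`. Pure proof file (nothing is asserted, no definition): discharges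
`Literature.NumberTheory.LFunctions.Lagarias1999_re_logDeriv_riemannXi_pos` (Lagarias 1999, eq. (1.4):
`Re ξ'/ξ(s) > 0` for `Re s > 1`) and `Literature.NumberTheory.LFunctions.Lagarias1999_riemannHypothesis_iff`
(eq. (1.5): `RH ⟺ Re ξ'/ξ(s) > 0` for `Re s > 1/2`) of `LagariasXiPositivity.lean`, as anticipated there ("(1.4) is
within reach of a literature-prover": the partial-fraction expansion behind Thm. 1.1 is PROVED in the tree).

Both follow from one pointwise criterion, proved here from the tree's partial fraction with multiplicities
`Re ξ'/ξ(s) = Σ_ρ m(ρ) Re 1/(s − ρ)` (`Literature.NumberTheory.LFunctions.hasSum_zeroOrder_mul_re_inv_sub`),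
re-indexed by the multiplicity-preserving involution `ρ ↦ 1 − ρ̄` of the non-trivial zeros
(`riemannZetaZeroOrder_conj_holds`, `riemannZetaZeroOrder_one_sub_holds`):

* `Lagarias1999Eq14.re_logDeriv_riemannXi_pos_of_offLine` — if `Re s > 1/2` and every OFF-LINE zero
  `ρ = β + iγ` satisfies `(β − 1/2)² < (σ − 1/2)² + (t − γ)²`, then `Re ξ'/ξ(s) > 0`: a symmetric pair of zeros
  `1/2 ± a + iγ` contributes `m · 2x(x² − a² + u²)/D > 0` (`x = σ − 1/2`, `u = t − γ`) at every point outside the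
  disc of radius `|a|` about `1/2 + iγ` (`Lagarias1999Eq14.msz_pair_pos`); the unsymmetrised form ("`σ >` every
  `Re ρ` ⟹ every term positive") is Lagarias's proof of Thm. 1.1 / Sondow–Dumitrescu Thm 1 /
  Matiyasevich–Saidak–Zvengrowski Thm 1.1.
* `Lagarias1999_re_logDeriv_riemannXi_pos_holds` — (1.4): for `Re s > 1` the hypothesis is void
  (`|β − 1/2| < 1/2 < σ − 1/2`).
* `Lagarias1999_riemannHypothesis_iff_holds` — (1.5): under RH the hypothesis is void; conversely positivity on
  `Re s > 1/2` excludes zeros there (Mathlib's `logDeriv` vanishes at a zero of `ξ`), and the functional equation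
  (`GeneralizedRH.riemannZeta_one_sub_eq_zero`, `riemannHypothesis_iff_strip_holds`) gives RH.

The same criterion, with its consequences for the crux `CofiniteCriticalLine` of route RuelleBand, is landed under
`Summits/RiemannHypothesis/RiemannHypothesis/Theorems/CofiniteCriticalLine/Negative/HorizontalMonotonicity.lean`
(which cannot be imported here: Literature does not import Summits).

## References

* J. C. Lagarias, *On a positivity property of the Riemann ξ-function*, Acta Arith. 89 (1999), 217–234,
  (1.4), (1.5), Thm. 1.1. [LagariasXiPositivity1999]
* J. Sondow, C. Dumitrescu, *A monotonicity property of Riemann's xi function and a reformulation of the Riemann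
  hypothesis*, Period. Math. Hungar. 60 (2010), 37–40, Thm 1. [SondowDumitrescu2010]
* Yu. Matiyasevich, F. Saidak, P. Zvengrowski, *Horizontal monotonicity of the modulus of the zeta function,
  L-functions, and related functions*, Acta Arith. 166 (2014), 189–200 = arXiv:1205.2773, Thm 1.1, Lemmas 2.1/2.3.
  [MatiyasevichSaidakZvengrowski2014]
-/

noncomputable section

open Complex Set Filter Topology
open scoped ComplexConjugate

namespace Literature.NumberTheory.LFunctions

namespace Lagarias1999Eq14

/-! ## The non-trivial zeros as a subtype, and the reflection `ρ ↦ 1 − ρ̄` -/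

/-- Membership in the tree's set of non-trivial zeros (`RHWave0.riemannZetaNontrivialZeros`) is
`ζ ρ = 0 ∧ 0 < re ρ < 1` (tree: `mem_riemannZetaNontrivialZeros_iff_holds`). [folklore] -/
theorem mem_nontrivialZeros_iff {ρ : ℂ} :
    ρ ∈ RHWave0.riemannZetaNontrivialZeros ↔ riemannZeta ρ = 0 ∧ 0 < ρ.re ∧ ρ.re < 1 :=
  mem_riemannZetaNontrivialZeros_iff_holds

/-- The zero set of `ζ` in the strip is stable under `ρ ↦ 1 − ρ̄` (conjugation `riemannZeta_conj` and the
functional equation, tree lemma `GeneralizedRH.riemannZeta_one_sub_eq_zero`). [folklore] -/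
theorem one_sub_conj_mem_nontrivialZeros {ρ : ℂ} (hρ : ρ ∈ RHWave0.riemannZetaNontrivialZeros) :
    1 - conj ρ ∈ RHWave0.riemannZetaNontrivialZeros := by
  rw [mem_nontrivialZeros_iff] at hρ ⊢
  obtain ⟨hz, h0, h1⟩ := hρ
  have hzc : riemannZeta (conj ρ) = 0 := by rw [riemannZeta_conj, hz, map_zero]
  refine ⟨GeneralizedRH.riemannZeta_one_sub_eq_zero hzc (by simpa using h0) (by simpa using h1), ?_, ?_⟩
  · simp only [sub_re, one_re, conj_re]; linarith
  · simp only [sub_re, one_re, conj_re]; linarith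

/-- The multiplicity is invariant under `ρ ↦ 1 − ρ̄` (tree: `riemannZetaZeroOrder_conj_holds`,
`riemannZetaZeroOrder_one_sub_holds`). [folklore] -/
theorem zeroOrder_one_sub_conj (ρ : RHWave0.riemannZetaNontrivialZeros) :
    riemannZetaZeroOrder (1 - conj (ρ : ℂ)) = riemannZetaZeroOrder (ρ : ℂ) := by
  obtain ⟨-, h0, h1⟩ := mem_nontrivialZeros_iff.1 ρ.2
  rw [riemannZetaZeroOrder_one_sub_holds (by simpa using h0) (by simpa using h1)]
  exact riemannZetaZeroOrder_conj_holds ρ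

/-- Every non-trivial zero has positive multiplicity. [folklore] -/
theorem zeroOrder_pos (ρ : RHWave0.riemannZetaNontrivialZeros) : 0 < riemannZetaZeroOrder (ρ : ℂ) := by
  obtain ⟨hz, -, h1⟩ := mem_nontrivialZeros_iff.1 ρ.2
  refine (riemannZetaZeroOrder_pos_iff ?_).2 hz
  intro h; rw [h] at h1; norm_num at h1

/-- There is a non-trivial zero (Hardy's theorem, proved in tree, gives infinitely many on the line).
[folklore] -/
theorem nonempty_nontrivialZeros : Nonempty RHWave0.riemannZetaNontrivialZeros := by
  obtain ⟨t, ht⟩ := hardy_infinite_zeros_on_critical_line_holds.nonempty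
  refine ⟨⟨1 / 2 + t * I, mem_nontrivialZeros_iff.2 ⟨ht, ?_, ?_⟩⟩⟩ <;> norm_num

/-! ## The Matiyasevich–Saidak–Zvengrowski pair computation -/

/-- MSZ pair lemma: for `x > 0` and `a² < x² + u²`,
`(x − a)/((x − a)² + u²) + (x + a)/((x + a)² + u²) > 0` (it equals `2x(x² − a² + u²)/D`). [folklore] -/
theorem msz_pair_pos {x a u : ℝ} (hx : 0 < x) (h : a ^ 2 < x ^ 2 + u ^ 2) :
    0 < (x - a) / ((x - a) ^ 2 + u ^ 2) + (x + a) / ((x + a) ^ 2 + u ^ 2) := by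
  have hP : 0 < (x - a) ^ 2 + u ^ 2 := by
    by_contra hP
    have h1 : (x - a) ^ 2 + u ^ 2 = 0 := le_antisymm (not_lt.1 hP) (by positivity)
    have hxa : x - a = 0 := by nlinarith [sq_nonneg (x - a), sq_nonneg u]
    have hu : u = 0 := by nlinarith [sq_nonneg (x - a), sq_nonneg u]
    have : a = x := by linarith
    rw [this, hu] at h; simp at h
  have hQ : 0 < (x + a) ^ 2 + u ^ 2 := by
    by_contra hQ
    have h1 : (x + a) ^ 2 + u ^ 2 = 0 := le_antisymm (not_lt.1 hQ) (by positivity)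
    have hxa : x + a = 0 := by nlinarith [sq_nonneg (x + a), sq_nonneg u]
    have hu : u = 0 := by nlinarith [sq_nonneg (x + a), sq_nonneg u]
    have : a = -x := by linarith
    rw [this, hu] at h; simp at h
  rw [div_add_div _ _ hP.ne' hQ.ne']
  refine div_pos ?_ (mul_pos hP hQ)
  have hid : (x - a) * ((x + a) ^ 2 + u ^ 2) + ((x - a) ^ 2 + u ^ 2) * (x + a) =
      2 * x * (x ^ 2 - a ^ 2 + u ^ 2) := by ring
  rw [hid]
  have : 0 < x ^ 2 - a ^ 2 + u ^ 2 := by linarith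
  positivity

/-- The pair lemma in zero coordinates: `σ > 1/2`, `(β − 1/2)² < (σ − 1/2)² + (t − γ)²` give
`(σ − β)/|s − ρ|² + (σ − (1 − β))/|s − (1 − ρ̄)|² > 0` (`ρ = β + iγ`, `1 − ρ̄ = (1 − β) + iγ`). [folklore] -/
theorem msz_pair_pos' {σ β t γ : ℝ} (hσ : 1 / 2 < σ) (h : (β - 1 / 2) ^ 2 < (σ - 1 / 2) ^ 2 + (t - γ) ^ 2) :
    0 < (σ - β) / ((σ - β) ^ 2 + (t - γ) ^ 2) + (σ - (1 - β)) / ((σ - (1 - β)) ^ 2 + (t - γ) ^ 2) := by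
  have h' := msz_pair_pos (x := σ - 1 / 2) (a := β - 1 / 2) (u := t - γ) (by linarith) h
  have e1 : σ - 1 / 2 - (β - 1 / 2) = σ - β := by ring
  have e2 : σ - 1 / 2 + (β - 1 / 2) = σ - (1 - β) := by ring
  rw [e1, e2] at h'
  exact h'

/-- `Re 1/(s − ρ) = (σ − β)/((σ − β)² + (t − γ)²)` — duplicate of
`Literature.NumberTheory.LFunctions.re_one_div_sub` (`ZetaLogDerivSeries.lean`), kept as a
deprecated alias (librarian dedup-01471). [folklore] -/
@[deprecated re_one_div_sub (since := "2026-08-16")]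
alias re_inv_sub_eq' := re_one_div_sub

/-! ## Pointwise MSZ criterion for `Re ξ'/ξ > 0` -/

/-- **Pointwise symmetrised Sondow–Dumitrescu / Lagarias criterion.** Let `re s > 1/2` and suppose every
OFF-LINE zero `ρ = β + iγ` of `ζ` satisfies `(β − 1/2)² < (σ − 1/2)² + (t − γ)²` (i.e. `s` lies outside
the closed disc centred at `1/2 + iγ` of radius `|β − 1/2| < 1/2`). Then `Re ξ'/ξ(s) > 0`.
Proof: `Re ξ'/ξ(s) = Σ_ρ m(ρ) Re 1/(s − ρ)` (tree, `hasSum_zeroOrder_mul_re_inv_sub`); symmetrise over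
`ρ ↦ 1 − ρ̄` (same multiplicity) and apply the pair lemma. The unsymmetrised argument (`σ >` every `Re ρ`
⟹ every term positive) is Sondow–Dumitrescu's Thm 1 as re-proved by Matiyasevich–Saidak–Zvengrowski
(Thm 1.1 via Lemmas 2.1/2.3) and Lagarias (1.4)–(1.5); the pairing sharpens it: the hypothesis is void under RH,
for `re s ≥ 1`, and at every height `t` at distance `≥ 1/2` from the ordinates of all off-line zeros.
[cite: SondowDumitrescu2010, Thm 1] [cite: MatiyasevichSaidakZvengrowski2014, Thm 1.1 and Lemma 2.3] -/
theorem re_logDeriv_riemannXi_pos_of_offLine {s : ℂ} (hs : 1 / 2 < s.re)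
    (hfar : ∀ ρ : ℂ, riemannZeta ρ = 0 → 0 < ρ.re → ρ.re < 1 → ρ.re ≠ 1 / 2 →
      (ρ.re - 1 / 2) ^ 2 < (s.re - 1 / 2) ^ 2 + (s.im - ρ.im) ^ 2) :
    0 < (logDeriv riemannXi s).re := by
  -- the hypothesis holds for ALL non-trivial zeros (on-line ones: `0 < (σ - 1/2)²`)
  have hall : ∀ ρ : ℂ, riemannZeta ρ = 0 → 0 < ρ.re → ρ.re < 1 →
      (ρ.re - 1 / 2) ^ 2 < (s.re - 1 / 2) ^ 2 + (s.im - ρ.im) ^ 2 := by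
    intro ρ hz h0 h1
    by_cases hne : ρ.re = 1 / 2
    · have h2 : (0 : ℝ) < (s.re - 1 / 2) ^ 2 := pow_pos (by linarith) 2
      rw [hne]
      nlinarith [sq_nonneg (s.im - ρ.im)]
    · exact hfar ρ hz h0 h1 hne
  -- `s` is not a zero of `ζ`
  have hζ : riemannZeta s ≠ 0 := by
    intro hz
    by_cases h1 : s.re < 1
    · have := hall s hz (by linarith) h1
      simp at this
    · exact riemannZeta_ne_zero_of_one_le_re (not_lt.1 h1) hz
  have hsum := hasSum_zeroOrder_mul_re_inv_sub hζ
  -- the reflection `ρ ↦ 1 - conj ρ` as a permutation (involution) of the non-trivial zeros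
  let φ : Equiv.Perm RHWave0.riemannZetaNontrivialZeros :=
    Function.Involutive.toPerm (fun ρ => ⟨1 - conj (ρ : ℂ), one_sub_conj_mem_nontrivialZeros ρ.2⟩)
      (fun ρ => Subtype.ext (by simp))
  have hφ : ∀ ρ : RHWave0.riemannZetaNontrivialZeros,
      ((φ ρ : RHWave0.riemannZetaNontrivialZeros) : ℂ) = 1 - conj (ρ : ℂ) := fun ρ => rfl
  set f : RHWave0.riemannZetaNontrivialZeros → ℝ :=
    fun ρ => (riemannZetaZeroOrder (ρ : ℂ) : ℝ) * (1 / (s - ρ)).re with hf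
  have hsum' : HasSum (f ∘ φ) (logDeriv riemannXi s).re := (Equiv.hasSum_iff φ).2 hsum
  have hg : HasSum (fun ρ => f ρ + f (φ ρ)) ((logDeriv riemannXi s).re + (logDeriv riemannXi s).re) :=
    hsum.add hsum'
  -- every symmetrised term is positive
  have hpos : ∀ ρ : RHWave0.riemannZetaNontrivialZeros, 0 < f ρ + f (φ ρ) := by
    intro ρ
    obtain ⟨hz, h0, h1⟩ := mem_nontrivialZeros_iff.1 ρ.2
    have hm : (0 : ℝ) < riemannZetaZeroOrder (ρ : ℂ) := by exact_mod_cast zeroOrder_pos ρ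
    have hkey := hall ρ hz h0 h1
    simp only [hf]
    rw [hφ, zeroOrder_one_sub_conj, re_one_div_sub, re_one_div_sub, ← mul_add]
    refine mul_pos hm ?_
    simp only [sub_re, one_re, conj_re, sub_im, one_im, conj_im, zero_sub, neg_neg]
    exact msz_pair_pos' hs hkey
  obtain ⟨ρ₀⟩ := nonempty_nontrivialZeros
  have htsum : 0 < ∑' ρ, (f ρ + f (φ ρ)) :=
    hg.summable.tsum_pos (fun ρ => (hpos ρ).le) ρ₀ (hpos ρ₀)
  rw [hg.tsum_eq] at htsum
  linarith

/-- Off-line zeros at heights far from `t` do not obstruct: if every off-line zero `ρ` has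
`|t − Im ρ| ≥ 1/2` then `Re ξ'/ξ(σ + it) > 0` for every `σ > 1/2`. [folklore] -/
theorem re_logDeriv_riemannXi_pos_of_offLine_height {σ t : ℝ} (hσ : 1 / 2 < σ)
    (hfar : ∀ ρ : ℂ, riemannZeta ρ = 0 → 0 < ρ.re → ρ.re < 1 → ρ.re ≠ 1 / 2 → 1 / 2 ≤ |t - ρ.im|) :
    0 < (logDeriv riemannXi (σ + t * I)).re := by
  refine re_logDeriv_riemannXi_pos_of_offLine (by simpa using hσ) fun ρ hz h0 h1 hne => ?_
  have hu := hfar ρ hz h0 h1 hne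
  have hβ : (ρ.re - 1 / 2) ^ 2 < (1 / 2) ^ 2 := by nlinarith
  have hσ' : 0 < ((σ : ℂ) + t * I).re - 1 / 2 := by simp; linarith
  have him : ((σ : ℂ) + t * I).im = t := by simp
  rw [him]
  have h14 : (1 / 2 : ℝ) ^ 2 ≤ (t - ρ.im) ^ 2 := by
    calc (1 / 2 : ℝ) ^ 2 ≤ |t - ρ.im| ^ 2 := by gcongr
      _ = (t - ρ.im) ^ 2 := sq_abs _
  nlinarith

/-- **Lagarias (1.4), unconditionally and on the closed half-plane**: `Re ξ'/ξ(s) > 0` for `re s ≥ 1`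
(every off-line zero has `|β − 1/2| < 1/2 ≤ σ − 1/2`). [cite: LagariasXiPositivity1999, eq. (1.4)] -/
theorem re_logDeriv_riemannXi_pos_of_one_le_re {s : ℂ} (hs : 1 ≤ s.re) : 0 < (logDeriv riemannXi s).re := by
  refine re_logDeriv_riemannXi_pos_of_offLine (by linarith) fun ρ _ h0 h1 _ => ?_
  have hβ : (ρ.re - 1 / 2) ^ 2 < (1 / 2) ^ 2 := by nlinarith
  have : (1 / 2 : ℝ) ^ 2 ≤ (s.re - 1 / 2) ^ 2 := by nlinarith
  nlinarith [sq_nonneg (s.im - ρ.im)]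

end Lagarias1999Eq14

open Lagarias1999Eq14 in
/-- **Discharge of `Lagarias1999_re_logDeriv_riemannXi_pos`** (Lagarias 1999, eq. (1.4)): `Re ξ'/ξ(s) > 0` for
`Re s > 1` — every off-line zero has `|β − 1/2| < 1/2 < σ − 1/2`, so the pointwise criterion applies with a void
obstruction. [cite: LagariasXiPositivity1999, eq. (1.4)] -/
theorem Lagarias1999_re_logDeriv_riemannXi_pos_holds : Lagarias1999_re_logDeriv_riemannXi_pos := by
  intro s hs
  refine re_logDeriv_riemannXi_pos_of_offLine (by linarith) fun ρ _ h0 h1 _ => ?_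
  have hβ : (ρ.re - 1 / 2) ^ 2 < (1 / 2) ^ 2 := by nlinarith
  have : (1 / 2 : ℝ) ^ 2 ≤ (s.re - 1 / 2) ^ 2 := by nlinarith
  nlinarith [sq_nonneg (s.im - ρ.im)]

open Lagarias1999Eq14 in
/-- **Discharge of `Lagarias1999_riemannHypothesis_iff`** (Lagarias 1999, eq. (1.5)): `RH ⟺ Re ξ'/ξ(s) > 0` for all
`Re s > 1/2`. `⟹`: under RH there is no off-line zero, so the criterion applies everywhere on `Re s > 1/2`.
`⟸`: Mathlib's `logDeriv` is `0` at a zero of `ξ`, so positivity excludes zeros of `ζ` with `1/2 < Re s < 1`;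
a zero with `0 < Re s < 1/2` reflects to one with `1/2 < Re (1 − s) < 1` (`GeneralizedRH.riemannZeta_one_sub_eq_zero`);
hence the strip form of RH (`riemannHypothesis_iff_strip_holds`). [cite: LagariasXiPositivity1999, eq. (1.5)] -/
theorem Lagarias1999_riemannHypothesis_iff_holds : Lagarias1999_riemannHypothesis_iff := by
  constructor
  · intro hRH s hs
    refine re_logDeriv_riemannXi_pos_of_offLine hs fun ρ hz h0 h1 hne => ?_
    exfalso
    refine hne (hRH ρ hz ?_ ?_)
    · rintro ⟨n, hn⟩
      have := congrArg Complex.re hn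
      simp at this
      linarith [(n.cast_nonneg : (0 : ℝ) ≤ n)]
    · rintro rfl
      norm_num at h1
  · intro h
    rw [show RiemannHypothesis ↔ RiemannHypothesisStrip from riemannHypothesis_iff_strip_holds]
    have key : ∀ s : ℂ, riemannZeta s = 0 → 1 / 2 < s.re → s.re < 1 → False := by
      intro s hz hs h1
      have hξ : riemannXi s = 0 := (riemannXi_eq_zero_iff_holds s).2 ⟨hz, by linarith, h1⟩
      have := h s hs
      rw [logDeriv_apply, hξ, div_zero, Complex.zero_re] at this
      exact lt_irrefl _ this
    intro s hz h0 h1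
    by_contra hne
    rcases lt_or_gt_of_ne hne with hlt | hgt
    · refine key (1 - s) (GeneralizedRH.riemannZeta_one_sub_eq_zero hz h0 h1) ?_ ?_
      · simp only [sub_re, one_re]; linarith
      · simp only [sub_re, one_re]; linarith
    · exact key s hz hgt h1

end Literature.NumberTheory.LFunctions

end
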